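import Literature.MathematicalPhysics.QuantumFieldTheory.Sweep1ShenZhuZhuProofs
import Summits.Ventures.YMGap.Thresholds.SharpUniqueness

/-!
# Venture YMGap — Theorem C, consequence IV: Shen–Zhu–Zhu's strong-coupling PHASE statement
# (torus states converge, unique infinite-volume limit, exponential decay of plaquette
# correlations) for `|β| < 1/(8d)`, conditionally on the three named facts

HONEST FRAMING: venture file (cell `pub-ymgap`, track (a), item A2). The tree's named fact
`shenZhuZhu_strongCoupling ρ` (`Sweep1`, S16: Shen–Zhu–Zhu CMP 400 (2023) Thm 1.2 / Rem 1.3 /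
Cor 1.6 in the periodic / free-boundary vocabulary; PROVED in the tree at the printed window
`|β_tree| < N/(16(d-1))`) has, for the concrete group `SU(N)`, the `β`-body `StrongCouplingPhaseAt d N β`
below: the periodic (torus) Wilson states at tree coupling `β = Nβ_SZZ` converge along the full
sequence `L → ∞` to a translation-invariant probability measure `μ`, every free-boundary
infinite-volume limit equals `μ`, and plaquette–plaquette covariances under `μ` decay exponentially
in the distance of the base points. KERNEL-CHECKED here: `StrongCouplingPhaseAt d N β` follows from
the cell's `MassGapAt d N (β/N)` (DLR uniqueness + SZZ clustering), by the tree's own route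
(`Sweep1ShenZhuZhuProofs`: torus limit points are DLR, uniqueness ⇒ convergence + invariance,
plaquette observables are Lipschitz cylinders). CONDITIONAL (three NAMED printed facts:
`bakryEmery_kernelLogSobolev`, `stroockZegarlinski_uniqueness`, `shenZhuZhu_massGap_transfer`):
`sharp_strongCouplingPhase` — the same phase statement for every `|β_tree| < N/(8d)`, i.e.
't Hooft `|β| < 1/(8d)` (printed: `1/(16(d-1))`; `d = 4`: `1/32` vs `1/48`), all `N ≥ 2`. Not an
unconditional theorem; nothing at physical couplings; no area law.

Reference: cell files `p2/UNIQUENESS-LEG.md`, `paper/gap-below-beta0prime.md` §7; H. Shen, R. Zhu,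
X. Zhu, CMP 400 (2023), Thm 1.2, Rem 1.3, Cor 1.6.
-/

noncomputable section

namespace Summit.Ventures.YMGap.HessianSharp

open MeasureTheory Filter Topology ProbabilityTheory
open Literature.MathematicalPhysics.QuantumFieldTheory
open Literature.MathematicalPhysics.QuantumLattice (LGConfig ymGibbsMeasures ymSpecification
  fundamentalRep continuous_fundamentalRep)

variable {d N : ℕ}

/-- **The strong-coupling phase statement at tree coupling `β`** for `SU(N)` lattice Yang–Mills on
`ℤ^d` — VERBATIM the `β`-body of the tree's named fact `shenZhuZhu_strongCoupling` (`Sweep1`, S16)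
for the concrete group `Matrix.specialUnitaryGroup (Fin N) ℂ`: there is a probability measure `μ`
such that (i) the periodic states `periodicState ρ β (L+1)` converge to `μ` on bounded continuous
functions, (ii) `μ` is translation invariant, (iii) every free-boundary infinite-volume limit
(`IsInfiniteVolumeLimit`) equals `μ`, (iv) `|Cov_μ(W_p, W_q)| ≤ C e^{-m |x_p - x_q|}` for all
plaquettes, some `C` and `m > 0`. -/
def StrongCouplingPhaseAt (d N : ℕ) (β : ℝ) : Prop :=
  ∃ μ : Measure (ZdGaugeConfig d (Matrix.specialUnitaryGroup (Fin N) ℂ)), IsProbabilityMeasure μ ∧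
    (∀ f : ZdGaugeConfig d (Matrix.specialUnitaryGroup (Fin N) ℂ) → ℝ, Continuous f →
      Bornology.IsBounded (Set.range f) →
        Tendsto (fun L : ℕ => ∫ U, f U ∂(periodicState (fundamentalRep (Fin N)) β (L + 1))) atTop
          (𝓝 (∫ U, f U ∂μ))) ∧
    (∀ a : Literature.Probability.LatticeModels.Site d, μ.map (ZdGaugeConfig.translate a) = μ) ∧
    (∀ μ' : Measure (ZdGaugeConfig d (Matrix.specialUnitaryGroup (Fin N) ℂ)),
      IsInfiniteVolumeLimit (fundamentalRep (Fin N)) β μ' → μ' = μ) ∧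
    ∃ C m : ℝ, 0 < m ∧ ∀ (x y : Literature.Probability.LatticeModels.Site d) (i j k l : Fin d),
      i < j → k < l →
        |cov[zdPlaquetteObs (fundamentalRep (Fin N)) x i j,
            zdPlaquetteObs (fundamentalRep (Fin N)) y k l; μ]| ≤
          C * Real.exp (-m * latticeNorm (x - y))

/-- The tree's fact `shenZhuZhu_strongCoupling (fundamentalRep (Fin N))` is `StrongCouplingPhaseAt`
on the printed window `|β| < N/(16(d-1))` (definitional repackaging). -/
theorem strongCouplingPhaseAt_of_shenZhuZhu_strongCoupling
    (h : shenZhuZhu_strongCoupling (d := d) (fundamentalRep (Fin N))) (hN : 2 ≤ N) (hd : 2 ≤ d)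
    {β : ℝ} (hβ : |β| < N / (16 * (d - 1))) : StrongCouplingPhaseAt d N β :=
  h hN (TorusAreaLaw.isSpecialUnitaryModel_fundamentalRep N) hd hβ

/-- **`MassGapAt` ⇒ the phase statement** (the tree's route `shenZhuZhu_strongCoupling_fundamentalRep`,
re-run at one coupling): DLR uniqueness + SZZ clustering at 't Hooft coupling `β/N` give convergence
of the torus states (limit points are DLR; `tendsto_integral_torusState_of_subsingleton`),
translation invariance (`map_configShift_eq_of_tendsto_torusState`), identification of every
free-boundary limit (`mem_ymGibbsMeasures_of_isInfiniteVolumeLimit`) and exponential decay of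
plaquette covariances (`abs_cov_zdPlaquetteObs_le_of_decay`, plaquette observables being Lipschitz
cylinders). -/
theorem strongCouplingPhaseAt_of_massGapAt (hN : 2 ≤ N) (hd : 2 ≤ d) {β : ℝ}
    (h : MassGapAt d N (β / N)) : StrongCouplingPhaseAt d N β := by
  classical
  haveI : SecondCountableTopology (Matrix (Fin N) (Fin N) ℂ) :=
    inferInstanceAs (SecondCountableTopology (Fin N → Fin N → ℂ))
  haveI : SecondCountableTopology (Matrix.specialUnitaryGroup (Fin N) ℂ) :=
    Topology.IsEmbedding.subtypeVal.secondCountableTopology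
  have hρc : Continuous (fundamentalRep (Fin N)) := continuous_fundamentalRep (Fin N)
  have hN0 : (0 : ℝ) < N := by exact_mod_cast (show 0 < N by omega)
  have hNβ : (N : ℝ) * (β / N) = β := mul_div_cancel₀ β hN0.ne'
  obtain ⟨⟨hsub, hne⟩, hdecay⟩ := h
  rw [hNβ] at hsub hne hdecay
  obtain ⟨μ, hμ⟩ := hne
  haveI : IsProbabilityMeasure μ := hμ.1
  have hlim : ∀ f : LGConfig d (Matrix.specialUnitaryGroup (Fin N) ℂ) → ℝ, Continuous f →
      ∀ C : ℝ, (∀ U, |f U| ≤ C) →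
      Tendsto (fun L : ℕ => ∫ U, f U ∂(torusState (fundamentalRep (Fin N)) β (L + 1))) atTop
        (𝓝 (∫ U, f U ∂μ)) := fun f hf C hC =>
    tendsto_integral_torusState_of_subsingleton (fundamentalRep (Fin N)) hρc hsub hμ hf hC
  refine ⟨μ, hμ.1, ?_, ?_, ?_, ?_⟩
  · -- convergence of the periodic states along the full sequence
    intro f hf hfb
    obtain ⟨C, hC⟩ := isBounded_iff_forall_norm_le.1 hfb
    have hC' : ∀ U, |f U| ≤ C := fun U => by
      simpa [Real.norm_eq_abs] using hC (f U) (Set.mem_range_self U)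
    simpa only [periodicState_eq_torusState] using hlim f hf C hC'
  · -- translation invariance
    intro a
    rw [translate_eq_configShift]
    exact map_configShift_eq_of_tendsto_torusState (fundamentalRep (Fin N)) hlim (-a)
  · -- uniqueness: free-boundary limits are DLR states
    intro μ' hμ'
    exact hsub (mem_ymGibbsMeasures_of_isInfiniteVolumeLimit (fundamentalRep (Fin N)) hρc hμ') hμ
  · -- exponential decay of plaquette–plaquette covariances
    obtain ⟨c, hc, hn⟩ := hdecay μ hμ
    obtain ⟨c₁, hc₁⟩ := hn 4
    exact ⟨_, c / Real.sqrt d, div_pos hc (Real.sqrt_pos.2 (by exact_mod_cast (show 0 < d by omega))),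
      fun x y i j k l hij hkl => abs_cov_zdPlaquetteObs_le_of_decay (by omega) hc hc₁ x y hij hkl⟩

/-- `|β| < N/(8d)` in tree units is `|β/N| < 1/(8d)` in 't Hooft units. -/
theorem abs_div_lt_sharpThreshold (hN : 1 ≤ N) {β : ℝ} (hβ : |β| < N / (8 * d)) :
    |β / N| < sharpThresholdSU d := by
  have hN0 : (0 : ℝ) < N := by exact_mod_cast hN
  rw [abs_div, Nat.abs_cast, div_lt_iff₀ hN0, sharpThresholdSU]
  calc |β| < N / (8 * d) := hβ
    _ = 1 / (8 * d) * N := by ring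

/-- **The strong-coupling phase statement for `|β_tree| < N/(8d)`** ('t Hooft `|β| < 1/(8d)`),
conditional on the three named printed facts (Bakry–Émery for the DLR kernels; Stroock–Zegarlinski;
SZZ Cor. 4.11 transfer): for `d, N ≥ 2`, the periodic `SU(N)` Wilson states converge to a
translation-invariant `μ`, every free-boundary infinite-volume limit equals `μ`, and plaquette
correlations under `μ` decay exponentially — the conclusion of the tree's `shenZhuZhu_strongCoupling`
(proved there for `|β| < N/(16(d-1))`) on the window `|β| < N/(8d)` (`d = 4`: `N/32` vs `N/48`). -/
theorem sharp_strongCouplingPhase (h₁ : bakryEmery_kernelLogSobolev d N)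
    (h₂ : stroockZegarlinski_uniqueness d N) (h₃ : shenZhuZhu_massGap_transfer d N) (hN : 2 ≤ N)
    (hd : 2 ≤ d) {β : ℝ} (hβ : |β| < N / (8 * d)) : StrongCouplingPhaseAt d N β :=
  strongCouplingPhaseAt_of_massGapAt hN hd
    (massGapBelow_sharp h₁ h₂ h₃ hd hN (β / N) (abs_div_lt_sharpThreshold (le_trans one_le_two hN) hβ))

/-- The printed window restated through `MassGapAt` (unconditional in the tree: `shen_zhu_zhu_holds`
via `massGapBelow_szz_of_shen_zhu_zhu`), as a consistency check of the repackaging. -/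
theorem szz_strongCouplingPhase (hN : 2 ≤ N) (hd : 2 ≤ d) {β : ℝ}
    (hβ : |β| < N / (16 * ((d : ℝ) - 1))) : StrongCouplingPhaseAt d N β := by
  have hN0 : (0 : ℝ) < N := by exact_mod_cast (show 0 < N by omega)
  have hβ' : |β / N| < 1 / (16 * ((d : ℝ) - 1)) := by
    rw [abs_div, Nat.abs_cast, div_lt_iff₀ hN0]
    calc |β| < N / (16 * ((d : ℝ) - 1)) := hβ
      _ = 1 / (16 * ((d : ℝ) - 1)) * N := by ring
  exact strongCouplingPhaseAt_of_massGapAt hN hd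
    (massGapBelow_szz_of_shen_zhu_zhu (shen_zhu_zhu_holds d N) hd hN (β / N) hβ')

/-! ## The infinite-volume limit of the torus states exists and is unique (A9 vocabulary) -/

/-- **DLR uniqueness ⇒ the unique thermodynamic limit of the torus states** (the tree's assembly
`Balaban1983to89.InfiniteVolumeSufficient.hasUniqueInfiniteVolumeLimit_of_subsingleton`, re-proved
inline to keep imports light): limit points exist, are DLR, and under uniqueness the full sequence of
torus states converges to the DLR state (`tendsto_integral_torusState_of_subsingleton`). -/
theorem hasUniqueInfiniteVolumeLimit_of_subsingleton' {β : ℝ}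
    (hsub : (ymGibbsMeasures (d := d) (fundamentalRep (Fin N)) β).Subsingleton) :
    Literature.MathematicalPhysics.QuantumLattice.HasUniqueInfiniteVolumeLimit (d := d)
      (fundamentalRep (Fin N)) β := by
  haveI : SecondCountableTopology (Matrix (Fin N) (Fin N) ℂ) :=
    inferInstanceAs (SecondCountableTopology (Fin N → Fin N → ℂ))
  haveI : SecondCountableTopology (Matrix.specialUnitaryGroup (Fin N) ℂ) :=
    Topology.IsEmbedding.subtypeVal.secondCountableTopology
  have hρ : Continuous (fundamentalRep (Fin N)) := continuous_fundamentalRep (Fin N)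
  obtain ⟨μ, hμlim⟩ :=
    Literature.MathematicalPhysics.QuantumLattice.infiniteVolumeLimitPoints_nonempty_holds (d := d)
      (fundamentalRep (Fin N)) hρ β
  have hμG : μ ∈ ymGibbsMeasures (fundamentalRep (Fin N)) β :=
    Literature.MathematicalPhysics.QuantumLattice.mem_ymGibbsMeasures_of_mem_infiniteVolumeLimitPoints_holds
      (fundamentalRep (Fin N)) hρ hμlim
  have hfull : Literature.MathematicalPhysics.QuantumLattice.IsInfiniteVolumeLimit
      (fundamentalRep (Fin N)) β μ := by
    refine ⟨hμG.1, fun F S _ hFc hFb => ?_⟩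
    obtain ⟨C, hC⟩ := hFb
    have hE : (fun k : ℕ => wilsonExpectation (L := id k + 1) (fundamentalRep (Fin N)) β
        (Literature.MathematicalPhysics.QuantumLattice.toTorusObservable (id k + 1) F)) =
        fun k => ∫ U, F U ∂(torusState (fundamentalRep (Fin N)) β (k + 1)) :=
      funext fun k => wilsonExpectation_toTorusObservable (fundamentalRep (Fin N)) β (k + 1) hFc.measurable
    rw [hE]
    exact tendsto_integral_torusState_of_subsingleton (fundamentalRep (Fin N)) hρ hsub hμG hFc hC
  refine ⟨μ, hfull, Set.eq_singleton_iff_unique_mem.2 ⟨hfull.mem_infiniteVolumeLimitPoints, fun ν hν => ?_⟩⟩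
  exact hsub (Literature.MathematicalPhysics.QuantumLattice.mem_ymGibbsMeasures_of_mem_infiniteVolumeLimitPoints_holds
    (fundamentalRep (Fin N)) hρ hν) hμG

/-- **The unique infinite-volume limit for `|β| < 1/(8d)`**, conditional on the Bakry–Émery and
Stroock–Zegarlinski facts: for `d, N ≥ 2` and every 't Hooft coupling `|β| < 1/(8d)`, the torus
`SU(N)` Wilson states at tree coupling `Nβ` converge along the full sequence `L → ∞` on bounded
continuous cylinder observables, and the limit is the only infinite-volume limit point
(`HasUniqueInfiniteVolumeLimit`, A9 `LatticeGaugeDLR`). -/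
theorem hasUniqueInfiniteVolumeLimit_sharp (h₁ : bakryEmery_kernelLogSobolev d N)
    (h₂ : stroockZegarlinski_uniqueness d N) (hd : 2 ≤ d) (hN : 2 ≤ N) {β : ℝ}
    (hβ : |β| < sharpThresholdSU d) :
    Literature.MathematicalPhysics.QuantumLattice.HasUniqueInfiniteVolumeLimit (d := d)
      (fundamentalRep (Fin N)) ((N : ℝ) * β) :=
  hasUniqueInfiniteVolumeLimit_of_subsingleton' (sharpUniqueness_of_logSobolev h₁ h₂ hd hN β hβ).1

end Summit.Ventures.YMGap.HessianSharp
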